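import Literature.MathematicalPhysics.QuantumFieldTheory.Balaban1983to89.B16Sect1Backgrounds
import Literature.MathematicalPhysics.QuantumFieldTheory.Balaban1983to89.B14Eq213DetSet

/-!
# `Balaban1983to89.B16Eq152JoinedDeterminingSets` — T. Bałaban, *Large field renormalization. II. Localization,
exponentiation, and bounds for the 𝐑 operation*, Commun. Math. Phys. **122** (1989) 355–392 [Balaban1989LargeFieldII]
(cell paper B16; PDF held `paper:balaban1989-cmp122-large-field-ii`, journal page = PDF page + 354), Sect. 1 p. 370
[PDF 16]: **(1.52)** — *"Take the determining sets 𝐁₁ = 𝐁″_k∪𝐁_h(Ω″˜_{h+1}), 𝐁₂ = 𝐁″_k∪𝐁_h((Ω″˜_{h+1})ᶜ), (1.52) where the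
operation of joining two determining sets is given by (2.14) [III], and take the corresponding functions U_{𝐁₁}, U_{𝐁₂}.
These functions are supported in the domains Ω″˜_{h+1}, (Ω″˜_{h+1})ᶜ correspondingly, and they are introduced in order to
break the configuration U⁰_k into two independent parts by the boundary conditions at the boundary ∂Ω″˜_{h+1}"* — AT
PRINT'S OWN INSTANCE: the joins (2.14) [III] with the LOCALIZED determining sets `𝐁_h(Ω)` of [III] (2.13) and the shrunk
domains `Ω^{∼−2}`, all three the tree's concrete objects of record (r11's `B14.Eq213DetSet.Bj`, `innerTwoT`, `joinBj`,
`minConfJoin`; rows B14.Eq2.13 ∕ B14.Eq2.14-2.15, `proved`), identified BY NAME with row B16.Eq1.52's declarations of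
record `Sect1Data.detB1` ∕ `detB2` ∕ `cfgU1` ∕ `cfgU2` (`…B16Sect1Backgrounds`, r13 gen 3) at the instance `with152`; the
*"supported in the domains"* sentence PROVED at the determining-set level from r11's `joinBj_subset_pts`, and its use —
the (1.53) splice `U_{1,2}` reads `U₁` only on `Ω″˜_{h+1}` and `U₂` only off it — PROVED (`cfgU12_eqOn`, `cfgU12_eqOff`).

statement-level skeleton of published theorems with citation tags; proofs where landed; nothing here is a claim about
the Yang–Mills mass gap

WHY (mega-formalization `lit-balaban`, block r13 = the B16 owner, gen 102; the cell lead's READING RULE FOR DEFINITION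
DISPLAYS: (a) *"typed WITH ITS BODY verbatim … on print's carrier, or at higher generality (printed objects entering as
parameters) PROVIDED print's own instance is IDENTIFIED by a kernel theorem with the tree's concrete objects at the place
where print consumes the display"*, (b) *"every printed sentence of the row that print USES downstream … is a kernel
theorem"*).  The data record `Sect1Data` (r13 gen 3) carries `𝐁_h(Ω″˜_{h+1})`, `𝐁_h((Ω″˜_{h+1})ᶜ)` and the shrunk domains
`(Ω″˜_{h+1})^{∼−2}`, `((Ω″˜_{h+1})ᶜ)^{∼−2}` as FREE fields (`detHT`, `detHTc`, `ΩppTm2`, `ΩppTcm2`) — READING (d) of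
`B15DeterminingSets` (*"the localized determining sets 𝔹_j(Ω) of [III] (2.13)/(2.16) … enter as explicit arguments"*).
Since then r11 has landed [III] (2.13)–(2.15) ON THE SAME CARRIER (`B14Eq213DetSet`, p363492): `Bj M₁ Ω j` = `𝐁_j(Ω)`
with body (the maximal sequence of `Ω`), `innerTwoT M₁ Ω j` = `Ω^{∼−2}`, `joinBj M₁ 𝔹 Ω j` = (2.14) at them, `minConfJoin`
= (2.15) `U_{𝐁,Ω}(·)`, and `joinBj_subset_pts` (*"both pieces of (2.14) are localized in Ω"*).  Here the record's four
free fields are REPLACED by those bodies (`with152`), after which (1.52) and the functions `U_{𝐁₁}`, `U_{𝐁₂}` ARE r11's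
(2.14)/(2.15) objects definitionally.

CONTENT.  §1 the instance `with152 M₁ D` and the identifications `detB1_with152 : 𝐁₁ = joinBj M₁ 𝐁″_k Ω″˜_{h+1} h`,
`detB2_with152 : 𝐁₂ = joinBj M₁ 𝐁″_k (Ω″˜_{h+1})ᶜ h` (both `rfl`), `cfgU1_with152 : U₁ = U_{𝐁″_k,Ω″˜_{h+1}}(datum (1.53))`,
`cfgU2_with152` (both `rfl`, r11's `minConfJoin`), `isMinimizer_cfgU1_with152` ∕ `…cfgU2…` ((2.12) for them BY NAME).
§2 the *"supported in the domains"* sentence: `detB1_with152_subset` (`𝐁₁ ⊆ Ω″˜_{h+1}` scale-wise at the positive scales),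
`detB2_with152_subset` (`𝐁₂ ⊆ (Ω″˜_{h+1})ᶜ`), `disjoint_detB1_detB2_with152` (*"two independent parts"* at the level of the
determining sets) — r11's `joinBj_subset_pts` BY NAME; the scale-`0` member is [III] (2.2)'s `Γ₀ = Ω₁ᶜ` (r11's READING
NOTE in `B14Eq213DetSet`: at the finest scale `𝐁_j(Ω)` carries everything outside `Ω₁`), hence `0 < n`.  §3 the use in
(1.53): `cfgU12_eqOff` (`U_{1,2} = U₂` on the bonds not meeting `Ω″˜_{h+1}`; the other half is `Sect1Data.cfgU12_eqOn`).
At a general record `D` (free fields) the same support statements hold under the located inclusions `Ω^{∼−2} ⊆ Ω`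
(`detB1_subset_of`, `detB2_subset_of`; [I] p. 257: `Ω^{∼−2}` = `Ω` with two layers of `M₁`-cubes removed).

Nothing printed is asserted as a fact: one `def` (the instance record `with152`, every field a body of record) and
theorems; no `sorry`, no new `def … : Prop`.  NOT certified here (row B16.Eq1.53's, cell GAPS C-adv3-84): the regularity
of `U_{1,2}` near `∂Ω″˜_{h+1}`; the function-level locality of `U_{𝐁,Ω}(·)` inside `Ω` is [III] (2.13)/(2.15)'s notion
(*"U(𝐁_j(Ω), ·) = U_{j,Ω}(·)"*, rows B14.Eq2.13 ∕ 2.14-2.15), of which only the determining-set half is a set-theoretic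
statement on this carrier.  Depends on: B16.Eq1.52, B16.Eq1.53 (this paper), [III] (2.13)–(2.15) [Balaban1988Convergent]
(r11's `B14Eq213DetSet`), [III] (2.2)/(2.10)–(2.12) (r12's `B15DeterminingSets`).
-/

namespace Literature.MathematicalPhysics.QuantumFieldTheory.Balaban1983to89.B16Eq152JoinedDeterminingSets

open Literature.MathematicalPhysics.QuantumFieldTheory.Balaban1983to89
open B15DeterminingSets B16Sect1Backgrounds B14.Eq213DetSet Set

variable {P : Params}

section General

variable {G : Type*} [GaugeGroup G] {av : ∀ i, Averaging P i G} {𝔤 : Type*} [AddCommGroup 𝔤] [Module ℝ 𝔤]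
variable (D : Sect1Data P G av 𝔤)

/-- The join (2.14) [III] lives over `Ω` as soon as the shrunk domain does: `(𝐁∪𝐁_j(Ω))_n ⊆ Ω^{(n)}` for `Ω^{∼−2} ⊆ Ω`
(both pieces are restricted to parts of `Ω`; no hypothesis on `𝐁_j(Ω)` is needed). [cite: Balaban1988Convergent, (2.14) p.257] -/
theorem join214_subset_pts (𝔹 𝔹Ω : DetSet P) {Ω Ωm2 : Set (Site P 0)} (h : Ωm2 ⊆ Ω) (n : ℕ) :
    join214 𝔹 𝔹Ω Ω Ωm2 n ⊆ pts n Ω := by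
  rintro y (hy | hy)
  · exact h hy.2
  · exact hy.2.1

/-- **(1.52), `𝐁₁` supported in `Ω″˜_{h+1}`** at a general record, under the located inclusion `(Ω″˜_{h+1})^{∼−2} ⊆ Ω″˜_{h+1}`
([I] p. 257: `Ω^{∼−2}` is `Ω` with two layers of `M₁`-cubes removed; `hm2`): every member of `𝐁₁` lies over `Ω″˜_{h+1}`.
[cite: Balaban1989LargeFieldII, (1.52) p.370] -/
theorem detB1_subset_of (hm2 : D.ΩppTm2 ⊆ D.ΩppT) (n : ℕ) : D.detB1 n ⊆ pts n D.ΩppT :=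
  join214_subset_pts D.detPP D.detHT hm2 n

/-- **(1.52), `𝐁₂` supported in `(Ω″˜_{h+1})ᶜ`** at a general record, under `((Ω″˜_{h+1})ᶜ)^{∼−2} ⊆ (Ω″˜_{h+1})ᶜ` (`hcm2`).
[cite: Balaban1989LargeFieldII, (1.52) p.370] -/
theorem detB2_subset_of (hcm2 : D.ΩppTcm2 ⊆ D.ΩppTᶜ) (n : ℕ) : D.detB2 n ⊆ pts n D.ΩppTᶜ :=
  join214_subset_pts D.detPP D.detHTc hcm2 n

/-- *"two independent parts"* at the level of the determining sets: `𝐁₁` and `𝐁₂` have no common member (general record,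
located inclusions). [cite: Balaban1989LargeFieldII, (1.52) p.370] -/
theorem disjoint_detB1_detB2_of (hm2 : D.ΩppTm2 ⊆ D.ΩppT) (hcm2 : D.ΩppTcm2 ⊆ D.ΩppTᶜ) (n : ℕ) :
    Disjoint (D.detB1 n) (D.detB2 n) :=
  Set.disjoint_left.2 fun _ h1 h2 => (detB2_subset_of D hcm2 n h2) (detB1_subset_of D hm2 n h1)

/-- **(1.53), the use of the supports**: `U_{1,2} = U₂` on every fine bond NOT meeting `Ω″˜_{h+1}` (the complement half of
`Sect1Data.cfgU12_eqOn`: *"U_{1,2} = U₁ on Ω″˜_{h+1}, U₂ on (Ω″˜_{h+1})ᶜ"*) — so (1.53) reads `U₁` only over `Ω″˜_{h+1}`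
and `U₂` only off it. [cite: Balaban1989LargeFieldII, (1.53) p.370] -/
theorem cfgU12_eqOff {b : PBond P 0} (hb : b ∉ bondsOf (pts 0 D.ΩppT)) : D.cfgU12 b = D.cfgU2 b := by
  classical
  simp only [Sect1Data.cfgU12, spliceAt, hb, if_false]

end General

/-! ## §1. The instance of record: (1.52) at the [III] (2.13)/(2.14) objects of r11 -/

section Instance

variable {G : Type*} [GaugeGroup G] {av : ∀ i, Averaging P i G} {𝔤 : Type*} [AddCommGroup 𝔤] [Module ℝ 𝔤]
variable (M₁ : ℕ) (D : Sect1Data P G av 𝔤)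

/-- The data record with its four free fields `𝐁_h(Ω″˜_{h+1})`, `𝐁_h((Ω″˜_{h+1})ᶜ)`, `(Ω″˜_{h+1})^{∼−2}`, `((Ω″˜_{h+1})ᶜ)^{∼−2}`
REPLACED by their bodies of record: r11's localized determining sets `𝐁_j(Ω) = Bj M₁ Ω j` of [III] (2.13) (at `j = h`)
and torus shrunk domains `Ω^{∼−2} = innerTwoT M₁ Ω h`; every other field unchanged. [cite: Balaban1989LargeFieldII, (1.52) p.370] -/
def with152 : Sect1Data P G av 𝔤 :=
  { D with detHT := Bj M₁ D.ΩppT D.h, detHTc := Bj M₁ D.ΩppTᶜ D.h,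
           ΩppTm2 := innerTwoT M₁ D.ΩppT D.h, ΩppTcm2 := innerTwoT M₁ D.ΩppTᶜ D.h }

/-- **(1.52), `𝐁₁`** p. 370 [PDF 16], verbatim: *"𝐁₁ = 𝐁″_k∪𝐁_h(Ω″˜_{h+1}) … where the operation of joining two determining
sets is given by (2.14) [III]"* — at the instance of record, row B16.Eq1.52's `detB1` IS r11's (2.14) join `joinBj M₁ 𝐁″_k
Ω″˜_{h+1} h` (definitional). [cite: Balaban1989LargeFieldII, (1.52) p.370] -/
theorem detB1_with152 : (with152 M₁ D).detB1 = joinBj M₁ D.detPP D.ΩppT D.h := rfl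

/-- **(1.52), `𝐁₂`**, verbatim: *"𝐁₂ = 𝐁″_k∪𝐁_h((Ω″˜_{h+1})ᶜ)"* — `detB2` IS `joinBj M₁ 𝐁″_k (Ω″˜_{h+1})ᶜ h` (definitional).
[cite: Balaban1989LargeFieldII, (1.52) p.370] -/
theorem detB2_with152 : (with152 M₁ D).detB2 = joinBj M₁ D.detPP D.ΩppTᶜ D.h := rfl

/-- *"take the corresponding functions U_{𝐁₁}, U_{𝐁₂}"* — the (1.53) configuration `U₁ = U_{𝐁₁}(V″↾_{Λᶜ}, M^k(U₀^{(AL)})↾_{Λ∩Ω″_k},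
1↾_{Z″_k∩Ω″˜_{h+1}})` of record (`Sect1Data.cfgU1`) IS r11's (2.15) function `U_{𝐁″_k,Ω″˜_{h+1}}(·) = minConfJoin` at the (1.53)
datum (definitional). [cite: Balaban1989LargeFieldII, (1.53) p.370] -/
theorem cfgU1_with152 : (with152 M₁ D).cfgU1 = minConfJoin M₁ D.bg D.detPP D.ΩppT D.h D.dataU1 := rfl

/-- Likewise `U₂ = U_{𝐁₂}(1↾_{(Ω″˜_{h+1})ᶜ∩Ω″˜²_{h+1}}, V″↾)` (`Sect1Data.cfgU2`) IS `U_{𝐁″_k,(Ω″˜_{h+1})ᶜ}(·)` at its datum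
(definitional). [cite: Balaban1989LargeFieldII, (1.53) p.370] -/
theorem cfgU2_with152 :
    (with152 M₁ D).cfgU2 = minConfJoin M₁ D.bg D.detPP D.ΩppTᶜ D.h (splice (D.ΩppTᶜ ∩ D.ΩppT2) 1 D.Vpp) := rfl

/-- `U₁` IS a minimal configuration of [III] (2.12) for `𝐁₁` and the (1.53) datum (r11's `isMinimizer_minConfJoin` BY NAME;
for a datum in the domain of the solution map). [cite: Balaban1989LargeFieldII, (1.53) p.370] -/
theorem isMinimizer_cfgU1_with152 (hV : D.dataU1 ∈ D.bg.dom (joinBj M₁ D.detPP D.ΩppT D.h)) :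
    IsMinimizer av D.bg.reg (joinBj M₁ D.detPP D.ΩppT D.h) D.dataU1 (with152 M₁ D).cfgU1 :=
  isMinimizer_minConfJoin D.bg hV

/-- `U₂` IS a minimal configuration of [III] (2.12) for `𝐁₂` and its (1.53) datum. [cite: Balaban1989LargeFieldII, (1.53) p.370] -/
theorem isMinimizer_cfgU2_with152
    (hV : splice (D.ΩppTᶜ ∩ D.ΩppT2) 1 D.Vpp ∈ D.bg.dom (joinBj M₁ D.detPP D.ΩppTᶜ D.h)) :
    IsMinimizer av D.bg.reg (joinBj M₁ D.detPP D.ΩppTᶜ D.h) (splice (D.ΩppTᶜ ∩ D.ΩppT2) 1 D.Vpp)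
      (with152 M₁ D).cfgU2 :=
  isMinimizer_minConfJoin D.bg hV

/-! ## §2. *"These functions are supported in the domains Ω″˜_{h+1}, (Ω″˜_{h+1})ᶜ correspondingly"* -/

/-- **p. 370, `𝐁₁`**: at the instance of record every member of `𝐁₁` at a positive scale lies over `Ω″˜_{h+1}` — r11's
`joinBj_subset_pts` (*"both pieces of (2.14) are localized in Ω"*) BY NAME; the scale-`0` member is [III] (2.2)'s
`Γ₀ = Ω₁ᶜ` (r11's READING NOTE), whence `0 < n`; `1 ≤ M₁` is the cube-size side condition of r11's torus geometry.
[cite: Balaban1989LargeFieldII, (1.52) p.370] -/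
theorem detB1_with152_subset (hM : 1 ≤ M₁) {n : ℕ} (h0 : 0 < n) : (with152 M₁ D).detB1 n ⊆ pts n D.ΩppT :=
  joinBj_subset_pts hM D.detPP D.ΩppT h0

/-- **p. 370, `𝐁₂`**: every positive-scale member of `𝐁₂` lies over `(Ω″˜_{h+1})ᶜ`. [cite: Balaban1989LargeFieldII, (1.52) p.370] -/
theorem detB2_with152_subset (hM : 1 ≤ M₁) {n : ℕ} (h0 : 0 < n) : (with152 M₁ D).detB2 n ⊆ pts n D.ΩppTᶜ :=
  joinBj_subset_pts hM D.detPP D.ΩppTᶜ h0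

/-- *"in order to break the configuration U⁰_k into two independent parts"* at the level of the determining sets: at every
positive scale `𝐁₁` and `𝐁₂` are DISJOINT. [cite: Balaban1989LargeFieldII, (1.52) p.370] -/
theorem disjoint_detB1_detB2_with152 (hM : 1 ≤ M₁) {n : ℕ} (h0 : 0 < n) :
    Disjoint ((with152 M₁ D).detB1 n) ((with152 M₁ D).detB2 n) :=
  Set.disjoint_left.2 fun _ h1 h2 => (detB2_with152_subset M₁ D hM h0 h2) (detB1_with152_subset M₁ D hM h0 h1)

/-- The shrunk domains of the instance satisfy the located inclusions of the general statements (`Ω^{∼−2} ⊆ Ω`, r11's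
`innerTwoT_subset`), so `detB1_subset_of` ∕ `detB2_subset_of` apply to `with152 M₁ D` at EVERY scale.
[cite: Balaban1988Convergent, (2.14) p.257] -/
theorem with152_inner_subset :
    (with152 M₁ D).ΩppTm2 ⊆ (with152 M₁ D).ΩppT ∧ (with152 M₁ D).ΩppTcm2 ⊆ (with152 M₁ D).ΩppTᶜ :=
  ⟨innerTwoT_subset D.ΩppT D.h, innerTwoT_subset D.ΩppTᶜ D.h⟩

/-- Hence at the instance `𝐁₁ ⊆ Ω″˜_{h+1}` holds at every scale, the scale-`0` member included (its join pieces are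
restricted to parts of `Ω″˜_{h+1}`). [cite: Balaban1989LargeFieldII, (1.52) p.370] -/
theorem detB1_with152_subset_all (n : ℕ) : (with152 M₁ D).detB1 n ⊆ pts n D.ΩppT :=
  detB1_subset_of (with152 M₁ D) (with152_inner_subset M₁ D).1 n

/-- … and `𝐁₂ ⊆ (Ω″˜_{h+1})ᶜ` at every scale. [cite: Balaban1989LargeFieldII, (1.52) p.370] -/
theorem detB2_with152_subset_all (n : ℕ) : (with152 M₁ D).detB2 n ⊆ pts n D.ΩppTᶜ :=
  detB2_subset_of (with152 M₁ D) (with152_inner_subset M₁ D).2 n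

/-! ## §3. The use in (1.53): `U_{1,2}` reads `U₁` over `Ω″˜_{h+1}` only and `U₂` off it only -/

open Classical in
/-- **(1.53) at the instance**: `U_{1,2} = U₁` on the bonds meeting `Ω″˜_{h+1}` and `= U₂` on the others — with `U₁`, `U₂`
r11's (2.15) functions for `𝐁₁`, `𝐁₂`. [cite: Balaban1989LargeFieldII, (1.53) p.370] -/
theorem cfgU12_with152 (b : PBond P 0) :
    (with152 M₁ D).cfgU12 b =
      if b ∈ bondsOf (pts 0 D.ΩppT) then minConfJoin M₁ D.bg D.detPP D.ΩppT D.h D.dataU1 b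
      else minConfJoin M₁ D.bg D.detPP D.ΩppTᶜ D.h (splice (D.ΩppTᶜ ∩ D.ΩppT2) 1 D.Vpp) b := by
  by_cases hb : b ∈ bondsOf (pts 0 D.ΩppT)
  · rw [if_pos hb, (with152 M₁ D).cfgU12_eqOn b hb]
    rfl
  · rw [if_neg hb, cfgU12_eqOff (with152 M₁ D) hb]
    rfl

end Instance

end Literature.MathematicalPhysics.QuantumFieldTheory.Balaban1983to89.B16Eq152JoinedDeterminingSets
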